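import Mathlib
import Summits.Ventures.HodgeRepro.OcticCMPointS3SignsExact
import Summits.Ventures.HodgeRepro.OcticCMPointTruncFourAll
import Summits.Ventures.HodgeRepro.OcticCMPointEightSign
import Summits.Ventures.HodgeRepro.OcticCMPointSixCard

/-!
# OcticCMPointS3SignsRamifiedEven — the root numbers of the octic point at the ramified places `𝔭₁, 𝔭₂ | 5` at every transcribed even conductor, in one statement

Blind re-derivation cell `pub-hodge-repro`, seat night-2 (gen 5).  Target tree path
`lean/Summits/Ventures/HodgeRepro/OcticCMPointS3SignsRamifiedEven.lean`.  The `𝔭`-half of the capstone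
(`OcticCMPointS3SignsEven` holds the inert rows and the combined (E3)):

* **`S3_signs_ramified_even`** — at `𝔭 | 5`, conductors `2` (gen 4's `DualModel.eps_sign_of_conductor_two`), `4`
  (`TruncModel.eps_four_all_p5`), `8` (`EightModel.eps_eight`) and `6` (`SixModel.eps_six_half`): for every
  conjugate-dual character `ε(½, ρ, ψ̃) = ρ(ϖ)^n × ρ(a₀)^{−1}` with `a₀` a `σ`-fixed unit congruent to the stationary
  point and `ρ(a₀)² = 1` — `ω(ϖ)^n` times a sign read on the `σ`-fixed residue (the Legendre symbol of the residue for
  the conjugate-symplectic class, `OcticCMPointS3ConjSymplectic` / `OcticCMPointSixConjSymplectic`; `+1` for the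
  conjugate-orthogonal one);
* **`S3_E3_ramified_even`** — (E3) at `𝔭` at `c = 4, 8, 6` for lines trivial on the `σ`-fixed units is the `ϖ`-part
  `π₀π₁ = π₂π₃` of N2 (the chain bridges `E3At_of_eight`, `E3At_of_six` live in the row modules).

**What this is not.**  Odd conductors (`5`, `7`, `> 8`) are NOT here; the four `χ′_j` of the face are NOT identified;
nothing here says anything about the status of the Hodge conjecture for CM abelian varieties, which is NOT proved.
-/

set_option autoImplicit false

noncomputable section

namespace Summit.Ventures.HodgeRepro.PeriodCloser

open GaussSumStability

/-- **The ramified places `𝔭 | 5`, even conductors `2`, `4`, `8`, `6`: `ε = ω(ϖ)^n × a sign read on the `σ`-fixed residue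
of the stationary point.** -/
theorem S3_signs_ramified_even (n : ℕ) :
    (∀ (ψ₀ : AddChar (ZMod 5) ℂ), ψ₀.IsPrimitive → ∀ (ω : LocalChar (DualNumber (ZMod 5))),
        (∃ z₀ ∈ DualModel.maxIdeal (ZMod 5), ω.unit (1 + z₀) ≠ 1) →
        (∀ x, ω.unit (DualModel.conj (ZMod 5) x) = ω.unit⁻¹ x) → ω.piVal ^ 2 = ω.unit (-1) →
        Even n →
        ∃ θ : MulChar (ZMod 5) ℂ, ∃ β : ZMod 5, β ≠ 0 ∧ ω.unit = DualModel.tameWild θ β ψ₀ ∧ θ β * θ β = 1 ∧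
          LocalChar.eps ((1 / 5 : ℝ) : ℂ) n ω (DualModel.psiTilde ψ₀) = ω.piVal ^ n * θ β) ∧
    (∀ (ψ₀ : AddChar (ZMod 5) ℂ), ψ₀.IsPrimitive → ∀ (ρ : LocalChar (TruncModel.Trunc (ZMod 5) 4)),
        (∀ x, ρ.unit (TruncModel.conjHom 4 x) = ρ.unit⁻¹ x) → ∀ a : (TruncModel.Trunc (ZMod 5) 4)ˣ,
        LocalChar.Primitive (TruncModel.psiTilde 4 ψ₀) TruncModel.I2 ρ a →
        TruncModel.coeffAt 4 0 (a : TruncModel.Trunc (ZMod 5) 4) ≠ 0 ∧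
          ρ.unit (algebraMap (ZMod 5) _ (TruncModel.coeffAt 4 0 (a : TruncModel.Trunc (ZMod 5) 4))) *
            ρ.unit (algebraMap (ZMod 5) _ (TruncModel.coeffAt 4 0 (a : TruncModel.Trunc (ZMod 5) 4))) = 1 ∧
          LocalChar.eps ((1 / 25 : ℝ) : ℂ) n ρ (TruncModel.psiTilde 4 ψ₀) =
            ρ.piVal ^ n * (ρ.unit (algebraMap (ZMod 5) _ (TruncModel.coeffAt 4 0 (a : TruncModel.Trunc (ZMod 5) 4))))⁻¹) ∧
    (∀ ρ : LocalChar EightModel.R8, (∀ x, ρ.unit (EightModel.conj x) = ρ.unit⁻¹ x) → ∀ a : EightModel.R8ˣ,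
        LocalChar.Primitive EightModel.psiTilde EightModel.I5 ρ a →
        ∃ a₀ : EightModel.R8ˣ, EightModel.conj (a₀ : EightModel.R8) = a₀ ∧ (a : EightModel.R8) - a₀ ∈ EightModel.I5 ∧
          ρ.unit (a₀ : EightModel.R8) * ρ.unit (a₀ : EightModel.R8) = 1 ∧
          LocalChar.eps (1 / 625) n ρ EightModel.psiTilde = ρ.piVal ^ n * (ρ.unit (a₀ : EightModel.R8))⁻¹) ∧
    (∀ ρ : LocalChar SixModel.R6, (∀ x, ρ.unit (SixModel.conj6 x) = ρ.unit⁻¹ x) → ∀ a : SixModel.R6ˣ,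
        LocalChar.Primitive SixModel.psi6 SixModel.I6 ρ a →
        ∃ a₀ : SixModel.R6ˣ, SixModel.conj6 (a₀ : SixModel.R6) = a₀ ∧ (a : SixModel.R6) - a₀ ∈ SixModel.I6 ∧
          ρ.unit (a₀ : SixModel.R6) * ρ.unit (a₀ : SixModel.R6) = 1 ∧
          LocalChar.eps (1 / 125) n ρ SixModel.psi6 = ρ.piVal ^ n * (ρ.unit (a₀ : SixModel.R6))⁻¹) := by
  refine ⟨?_, ?_, ?_, ?_⟩
  · intro ψ₀ h₀ ω hcond hσω hπ2 hn
    obtain ⟨θ, β, hβ, hωeq, hθ, heps, -⟩ :=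
      DualModel.eps_sign_of_conductor_two ω ψ₀ h₀ hcond hσω hπ2 n hn _ DualModel.kappa_mul_card_p5
    exact ⟨θ, β, hβ, hωeq, hθ, heps⟩
  · intro ψ₀ h₀ ρ hσ a hρ
    exact TruncModel.eps_four_all_p5 ψ₀ h₀ n ρ hσ a hρ
  · intro ρ hσ a hρ
    exact EightModel.eps_eight n ρ hσ a hρ
  · intro ρ hσ a hρ
    exact SixModel.eps_six_half n ρ hσ a hρ

/-- **(E3) at the ramified places `𝔭 | 5` at the even conductors `4`, `8`, `6` from the `ϖ`-part of N2**, for lines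
trivial on the `σ`-fixed units (`TruncModel.E3_four_all`, `EightModel.E3_eight`, `SixModel.E3_six`). -/
theorem S3_E3_ramified_even (n : ℕ) :
    (∀ (ψ₀ : AddChar (ZMod 5) ℂ), ψ₀.IsPrimitive → ∀ (ρ : Fin 4 → LocalChar (TruncModel.Trunc (ZMod 5) 4)),
        (∀ j x, (ρ j).unit (TruncModel.conjHom 4 x) = (ρ j).unit⁻¹ x) →
        (∀ j (r : ZMod 5), r ≠ 0 → (ρ j).unit (algebraMap (ZMod 5) _ r) = 1) →
        ∀ a : Fin 4 → (TruncModel.Trunc (ZMod 5) 4)ˣ,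
        (∀ j, LocalChar.Primitive (TruncModel.psiTilde 4 ψ₀) TruncModel.I2 (ρ j) (a j)) →
        (ρ 0).piVal * (ρ 1).piVal = (ρ 2).piVal * (ρ 3).piVal →
        LocalChar.eps ((1 / 25 : ℝ) : ℂ) n (ρ 0) (TruncModel.psiTilde 4 ψ₀) *
            LocalChar.eps ((1 / 25 : ℝ) : ℂ) n (ρ 1) (TruncModel.psiTilde 4 ψ₀) =
          LocalChar.eps ((1 / 25 : ℝ) : ℂ) n (ρ 2) (TruncModel.psiTilde 4 ψ₀) *
            LocalChar.eps ((1 / 25 : ℝ) : ℂ) n (ρ 3) (TruncModel.psiTilde 4 ψ₀)) ∧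
    (∀ (ρ : Fin 4 → LocalChar EightModel.R8), (∀ j x, (ρ j).unit (EightModel.conj x) = (ρ j).unit⁻¹ x) →
        (∀ j (u : EightModel.R8ˣ), EightModel.conj (u : EightModel.R8) = u → (ρ j).unit (u : EightModel.R8) = 1) →
        ∀ a : Fin 4 → EightModel.R8ˣ, (∀ j, LocalChar.Primitive EightModel.psiTilde EightModel.I5 (ρ j) (a j)) →
        (ρ 0).piVal * (ρ 1).piVal = (ρ 2).piVal * (ρ 3).piVal →
        LocalChar.eps (1 / 625) n (ρ 0) EightModel.psiTilde * LocalChar.eps (1 / 625) n (ρ 1) EightModel.psiTilde =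
          LocalChar.eps (1 / 625) n (ρ 2) EightModel.psiTilde * LocalChar.eps (1 / 625) n (ρ 3) EightModel.psiTilde) ∧
    (∀ (ρ : Fin 4 → LocalChar SixModel.R6), (∀ j x, (ρ j).unit (SixModel.conj6 x) = (ρ j).unit⁻¹ x) →
        (∀ j (u : SixModel.R6ˣ), SixModel.conj6 (u : SixModel.R6) = u → (ρ j).unit (u : SixModel.R6) = 1) →
        ∀ a : Fin 4 → SixModel.R6ˣ, (∀ j, LocalChar.Primitive SixModel.psi6 SixModel.I6 (ρ j) (a j)) →
        (ρ 0).piVal * (ρ 1).piVal = (ρ 2).piVal * (ρ 3).piVal →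
        LocalChar.eps (1 / 125) n (ρ 0) SixModel.psi6 * LocalChar.eps (1 / 125) n (ρ 1) SixModel.psi6 =
          LocalChar.eps (1 / 125) n (ρ 2) SixModel.psi6 * LocalChar.eps (1 / 125) n (ρ 3) SixModel.psi6) :=
  ⟨fun ψ₀ h₀ ρ hσ hfix a hρ hN2 =>
      TruncModel.E3_four_all (by decide) ψ₀ h₀ n ρ hσ hfix a hρ _ (by rw [ZMod.card]; norm_num) hN2,
    fun ρ hσ hfix a hρ hN2 => EightModel.E3_eight n ρ hσ hfix a hρ hN2,
    fun ρ hσ hfix a hρ hN2 => SixModel.E3_six n ρ hσ hfix a hρ _ SixModel.kappa_mul_card_six hN2⟩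

end Summit.Ventures.HodgeRepro.PeriodCloser

end
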